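import Mathlib.Combinatorics.Enumerative.DoubleCounting
import Mathlib.Analysis.Complex.ExponentialBounds
import Literature.ModelTheory.FiniteModelTheory.AtseriasDawar3Xor
import Literature.ModelTheory.FiniteModelTheory.XorLocalConsistency
import Literature.Probability.Moments.HoeffdingCounting
import Literature.Combinatorics.Expanders.BoundedConcentrator
import HarnessLib

/-!
# Atserias–Dawar 2019: the local-consistency gap for 3XOR — proof of the named fact

Topic `Literature/ModelTheory/FiniteModelTheory`; discharges the named fact
`AtseriasDawar2019_xorLocalGap` of `AtseriasDawar3Xor.lean` (the sentence opening the printed proof of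
Theorem 8 of A. Atserias, A. Dawar, *Definable inapproximability: new challenges for duplicator*,
J. Logic Comput. 29 (2019), arXiv:1806.11307: "By combining Lemma 5 with Lemma 4, there is a family of
systems `(S_k)_{k ≥ 1}` with `O(k)` variables and equations such that `G(S_k)` is not
`(1/2+ε)`-satisfiable but `S_k` is `k`-locally satisfiable"). Everything here is PROVED.

The printed proof has three ingredients, mirrored here:

1. (Lemma 5, `lem:linear-local-bound`, first sentence of its proof: "let `n₀` be sufficiently large that
   for every `n ≥ n₀` there exists a … bipartite unique-neighbour expander graph with parameters
   `(rn, n, 3, αn, β)`. For the existence of such graphs … see [Vadhan's survey]".) The paper CITES the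
   existence of the expander; here it is PROVED by the textbook union bound over the random model
   "every equation picks a uniformly random 3-subset of the `n` variables" (`exists_threeUniformExpander`):
   a set `T` of `t ≤ s` equations whose variables `N(T)` number fewer than `7t/4` lies, together with a
   superset `W ⊇ N(T)` of size `w = ⌊(7t-1)/4⌋`, in one of `C(m,t)·C(n,w)` boxes of
   `C(w,3)^t·C(n,3)^{m-t}` systems, and `Σ_t C(m,t) C(n,w) C(w,3)^t C(n,3)^{m-t} < C(n,3)^m` as soon as
   `s·(432c)⁴ ≤ n` (`m ≤ cn`; per-size estimate `expanderTerm_le`, the arithmetic of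
   `Literature.Combinatorics.Expanders.exists_hallExpander` with `k! C(n,k) ≤ n^k`, `k^k ≤ 3^k k!`).
   Vertex expansion `4|N(T)| ≥ 7|T|` gives unique-neighbour (boundary) expansion `|T| ≤ 2|∂T|` by
   counting incidences (`card_le_two_mul_card_boundary`).
2. (Lemma 5, Claims 6–7.) On such a boundary expander every right-hand side `b` makes `Ax = b`
   `k`-locally satisfiable for `4k ≤ s`: the tree already proves Duplicator's strategy DIRECTLY from
   boundary expansion by the symmetric-difference argument (`XorSystem.good_empty`, `XorSystem.good_extend`
   in `XorLocalConsistency.lean`) instead of the printed detour through Ben-Sasson–Wigderson width and the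
   Atserias–Dalmau characterisation; `isLocallySat_inst` packages it as an `Xor3.LocalSatStrategy`.
3. (Lemma 4, `lem:both-extremal`, the half about `G(Ax=b)`.) For a uniformly random `b`, Hoeffding's
   inequality for the per-equation satisfied fractions `Y_{f,u}` and a union bound over the `4^n`
   assignments `f` of `G(Ax=b)` show that `G(Ax=b)` is not `(1/2+ε)`-satisfiable with positive
   probability once `4^n < e^{2ε²m}` (`exists_rhs_not_isCSat_double`, via the tree's counting Hoeffding
   inequality `Literature.Probability.Moments.hoeffding_count_pi`; the printed case analysis showing
   `𝔼 Y_{f,u} = 1/2` is replaced by the observation `Y_{f,u}(b_u = 0) + Y_{f,u}(b_u = 1) = 8`, and the range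
   `[0, 8]` of `Y` is all Hoeffding needs).
4. Assembly (`AtseriasDawar2019_xorLocalGap_holds`): for `ε > 0` put `c₁ = max ⌈1/ε²⌉ 1`, `L = 432c₁`; for
   `k ≥ 1` take `n = 8L⁴k` variables, `m = c₁n` equations, radius `s = 4k`.

## References

* [AtseriasDawar2019] A. Atserias, A. Dawar, *Definable inapproximability: new challenges for
  duplicator*, J. Logic Comput. 29 (2019), arXiv:1806.11307, §3.2: Lemma 4 (lem:both-extremal), Lemma 5
  (lem:linear-local-bound) with Claims 6–7, proof of Theorem 8 (thm:3lin-onesided). Read: arXiv text,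
  chunks 10–13 of `lit read arxiv:1806.11307`.
* S. Vadhan, *Pseudorandomness*, Found. Trends TCS 7 (2012), Thm. 4.4 with Problem 4.1 (existence of
  bipartite (unique-neighbour) expanders by the probabilistic method) — the source's [VadhanSurvey].
* W. Hoeffding, *Probability inequalities for sums of bounded random variables*, JASA 58 (1963), Thm. 2.
-/

namespace Literature.ModelTheory.FiniteModelTheory

open Finset

namespace Xor3Gap

/-! ### 1. Three-uniform unique-neighbour expanders exist (counting) -/

section Expander

/-- **The per-size estimate of the union bound.** For `1 ≤ t`, `4w ≤ 7t`, `m ≤ cn` and `t·(432c)⁴ ≤ n`: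
`C(m,t) · C(n,w) · C(w,3)^t · 2^t ≤ C(n,3)^t`. Chain: `C(w,3) n³ ≤ C(n,3) w³`; `t! C(m,t) ≤ m^t`,
`w! C(n,w) ≤ n^w`; `t^t ≤ 3^t t!`, `w^w ≤ 3^w w!`; then with `w ≤ 2t`, `e = 2t - w`:
`m^t n^w w^{3t} 6^t 3^w ≤ (432c)^t t^e · t^t n^t n^w w^w ≤ n^e · t^t n^t n^w w^w` because
`n^e ≥ (t L⁴)^e ≥ t^e L^t` for `L = 432c` and `t ≤ 4e`. [folklore] -/
theorem expanderTerm_le {t w n m c : ℕ} (ht : 1 ≤ t) (hw : 4 * w ≤ 7 * t) (hc : 1 ≤ c)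
    (hm : m ≤ c * n) (hn : t * (432 * c) ^ 4 ≤ n) :
    m.choose t * n.choose w * (w.choose 3) ^ t * 2 ^ t ≤ (n.choose 3) ^ t := by
  have hw2 : w ≤ 2 * t := by omega
  obtain ⟨e, he⟩ : ∃ e, w + e = 2 * t := ⟨2 * t - w, by omega⟩
  have hte : t ≤ 4 * e := by omega
  obtain ⟨L, hL⟩ : ∃ L, 432 * c = L := ⟨_, rfl⟩
  rw [hL] at hn
  have hL1 : 1 ≤ L := by omega
  have hn1 : 1 ≤ n := by
    have : 1 ≤ t * L ^ 4 := Nat.one_le_iff_ne_zero.2 (by positivity)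
    omega
  have hwn : w ≤ n := by
    have h1 : 2 * t ≤ t * L ^ 4 := by
      have : 2 ≤ L ^ 4 := by
        calc (2 : ℕ) ≤ 1 ^ 4 + 1 := by norm_num
          _ ≤ L ^ 4 := by
            have := Nat.pow_le_pow_left hL1 4
            have h432 : 432 ^ 4 ≤ L ^ 4 := Nat.pow_le_pow_left (by omega) 4
            omega
      calc 2 * t = t * 2 := by ring
        _ ≤ t * L ^ 4 := Nat.mul_le_mul_left _ this
    omega
  -- (C): the core inequality after clearing binomials and factorials
  have key : L ^ t * t ^ e ≤ n ^ e := by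
    calc L ^ t * t ^ e ≤ L ^ (4 * e) * t ^ e :=
          Nat.mul_le_mul_right _ (Nat.pow_le_pow_right hL1 hte)
      _ = (t * L ^ 4) ^ e := by rw [mul_pow t, ← pow_mul, mul_comm]
      _ ≤ n ^ e := Nat.pow_le_pow_left hn e
  have hC : m ^ t * n ^ w * w ^ (3 * t) * 2 ^ t * 3 ^ t * 3 ^ w ≤ t ^ t * w ^ w * n ^ (3 * t) := by
    have h3t : 3 * t = w + (t + e) := by omega
    have h3t' : 3 * t = t + w + e := by omega
    have h2te : 2 ^ (t + e) ≤ (2 : ℕ) ^ (3 * t) := Nat.pow_le_pow_right (by norm_num) (by omega)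
    have h3w : 3 ^ w ≤ (3 : ℕ) ^ (2 * t) := Nat.pow_le_pow_right (by norm_num) hw2
    have h8 : (2 : ℕ) ^ (3 * t) = 8 ^ t := by rw [pow_mul]; norm_num
    have h9 : (3 : ℕ) ^ (2 * t) = 9 ^ t := by rw [pow_mul]; norm_num
    have h432 : L ^ t = 8 ^ t * 2 ^ t * 3 ^ t * 9 ^ t * c ^ t := by
      rw [← hL, show 432 * c = 8 * 2 * 3 * 9 * c by ring]
      simp only [mul_pow]
    calc m ^ t * n ^ w * w ^ (3 * t) * 2 ^ t * 3 ^ t * 3 ^ w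
        ≤ (c * n) ^ t * n ^ w * w ^ (3 * t) * 2 ^ t * 3 ^ t * 3 ^ (2 * t) := by gcongr
      _ = c ^ t * n ^ t * n ^ w * (w ^ w * w ^ (t + e)) * 2 ^ t * 3 ^ t * 9 ^ t := by
          rw [mul_pow, h3t, pow_add, h9]
      _ ≤ c ^ t * n ^ t * n ^ w * (w ^ w * (2 * t) ^ (t + e)) * 2 ^ t * 3 ^ t * 9 ^ t := by gcongr
      _ = c ^ t * n ^ t * n ^ w * w ^ w * 2 ^ (t + e) * (t ^ t * t ^ e) * 2 ^ t * 3 ^ t * 9 ^ t := by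
          rw [mul_pow, pow_add t]; ring
      _ ≤ c ^ t * n ^ t * n ^ w * w ^ w * 2 ^ (3 * t) * (t ^ t * t ^ e) * 2 ^ t * 3 ^ t * 9 ^ t := by
          gcongr
      _ = (L ^ t * t ^ e) * (t ^ t * n ^ t * n ^ w * w ^ w) := by rw [h8, h432]; ring
      _ ≤ n ^ e * (t ^ t * n ^ t * n ^ w * w ^ w) := Nat.mul_le_mul_right _ key
      _ = t ^ t * w ^ w * n ^ (3 * t) := by rw [h3t', pow_add, pow_add]; ring
  -- (B): clearing the factorials
  have hB : m.choose t * n.choose w * w ^ (3 * t) * 2 ^ t ≤ n ^ (3 * t) := by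
    have hfa : t.factorial * m.choose t ≤ m ^ t := by
      rw [← Nat.descFactorial_eq_factorial_mul_choose]; exact Nat.descFactorial_le_pow m t
    have hfb : w.factorial * n.choose w ≤ n ^ w := by
      rw [← Nat.descFactorial_eq_factorial_mul_choose]; exact Nat.descFactorial_le_pow n w
    have htt : t ^ t ≤ 3 ^ t * t.factorial :=
      Literature.Combinatorics.Expanders.pow_self_le_three_pow_mul_factorial t
    have hww : w ^ w ≤ 3 ^ w * w.factorial :=
      Literature.Combinatorics.Expanders.pow_self_le_three_pow_mul_factorial w
    have hpos : 0 < t.factorial * w.factorial * 3 ^ t * 3 ^ w := by positivity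
    refine Nat.le_of_mul_le_mul_left ?_ hpos
    calc t.factorial * w.factorial * 3 ^ t * 3 ^ w * (m.choose t * n.choose w * w ^ (3 * t) * 2 ^ t)
        = (t.factorial * m.choose t) * (w.factorial * n.choose w) * w ^ (3 * t) * 2 ^ t * 3 ^ t *
            3 ^ w := by ring
      _ ≤ m ^ t * n ^ w * w ^ (3 * t) * 2 ^ t * 3 ^ t * 3 ^ w := by gcongr
      _ ≤ t ^ t * w ^ w * n ^ (3 * t) := hC
      _ ≤ (3 ^ t * t.factorial) * (3 ^ w * w.factorial) * n ^ (3 * t) := by gcongr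
      _ = t.factorial * w.factorial * 3 ^ t * 3 ^ w * n ^ (3 * t) := by ring
  -- (A): the ratio of binomial coefficients `C(w,3)/C(n,3) ≤ (w/n)³`
  have hcw : w.choose 3 * n ^ 3 ≤ n.choose 3 * w ^ 3 :=
    Literature.Combinatorics.Expanders.choose_mul_pow_le_choose_mul_pow hwn 3
  have hcwt : (w.choose 3) ^ t * n ^ (3 * t) ≤ (n.choose 3) ^ t * w ^ (3 * t) := by
    calc (w.choose 3) ^ t * n ^ (3 * t) = (w.choose 3 * n ^ 3) ^ t := by
          rw [mul_pow, ← pow_mul, mul_comm 3 t]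
      _ ≤ (n.choose 3 * w ^ 3) ^ t := Nat.pow_le_pow_left hcw t
      _ = (n.choose 3) ^ t * w ^ (3 * t) := by rw [mul_pow, ← pow_mul, mul_comm 3 t]
  have hnpos : 0 < n ^ (3 * t) := by positivity
  refine Nat.le_of_mul_le_mul_right ?_ hnpos
  calc m.choose t * n.choose w * (w.choose 3) ^ t * 2 ^ t * n ^ (3 * t)
      = m.choose t * n.choose w * 2 ^ t * ((w.choose 3) ^ t * n ^ (3 * t)) := by ring
    _ ≤ m.choose t * n.choose w * 2 ^ t * ((n.choose 3) ^ t * w ^ (3 * t)) :=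
        Nat.mul_le_mul_left _ hcwt
    _ = (m.choose t * n.choose w * w ^ (3 * t) * 2 ^ t) * (n.choose 3) ^ t := by ring
    _ ≤ n ^ (3 * t) * (n.choose 3) ^ t := Nat.mul_le_mul_right _ hB
    _ = (n.choose 3) ^ t * n ^ (3 * t) := mul_comm _ _

/-- **Boundary from vertex expansion** (counting incidences): if every scope `S u`, `u ∈ T`, has exactly
three elements then `2 |N(T)| ≤ 3 |T| + |∂T|`, because `Σ_{v ∈ N(T)} deg_T(v) = 3|T|` and every
non-boundary variable of `N(T)` has degree at least two. [folklore] -/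
theorem two_mul_card_biUnion_le {U V : Type*} [DecidableEq U] [DecidableEq V] (S : U → Finset V)
    (T : Finset U) (h3 : ∀ u ∈ T, (S u).card = 3) :
    2 * (T.biUnion S).card ≤ 3 * T.card + (XorSystem.boundary S T).card := by
  classical
  set N := T.biUnion S with hN
  have hdc : ∑ u ∈ T, (N.bipartiteAbove (fun u v => v ∈ S u) u).card =
      ∑ v ∈ N, (T.bipartiteBelow (fun u v => v ∈ S u) v).card :=
    sum_card_bipartiteAbove_eq_sum_card_bipartiteBelow _
  have hleft : ∑ u ∈ T, (N.bipartiteAbove (fun u v => v ∈ S u) u).card = 3 * T.card := by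
    rw [mul_comm, sum_const_nat fun u hu => ?_]
    have : N.bipartiteAbove (fun u v => v ∈ S u) u = S u := by
      ext v
      simp only [mem_bipartiteAbove, and_iff_right_iff_imp]
      exact fun hv => mem_biUnion.2 ⟨u, hu, hv⟩
    rw [this, h3 u hu]
  have hsub : XorSystem.boundary S T ⊆ N := filter_subset _ _
  have hright : ∑ v ∈ N, (if v ∈ XorSystem.boundary S T then 1 else 2) ≤
      ∑ v ∈ N, (T.bipartiteBelow (fun u v => v ∈ S u) v).card := by
    refine sum_le_sum fun v hv => ?_
    have heq : T.bipartiteBelow (fun u v => v ∈ S u) v = T.filter fun u => v ∈ S u := rfl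
    have hpos : 1 ≤ (T.filter fun u => v ∈ S u).card := by
      obtain ⟨u, hu, hvu⟩ := mem_biUnion.1 hv
      exact card_pos.2 ⟨u, mem_filter.2 ⟨hu, hvu⟩⟩
    rw [heq]
    split_ifs with hb
    · exact hpos
    · have hne : (T.filter fun u => v ∈ S u).card ≠ 1 := fun h1 =>
        hb (by rw [XorSystem.boundary, mem_filter]; exact ⟨hv, h1⟩)
      omega
  have hsplit : ∑ v ∈ N, (if v ∈ XorSystem.boundary S T then 1 else 2) =
      (XorSystem.boundary S T).card + (N.card - (XorSystem.boundary S T).card) * 2 := by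
    rw [sum_ite, sum_const, sum_const, smul_eq_mul, smul_eq_mul, mul_one, filter_mem_eq_inter,
      inter_eq_right.2 hsub, filter_not, filter_mem_eq_inter, inter_eq_right.2 hsub,
      card_sdiff_of_subset hsub]
  have hbN : (XorSystem.boundary S T).card ≤ N.card := card_le_card hsub
  have := hright
  rw [hsplit, ← hdc, hleft] at this
  omega

/-- **Unique-neighbour expansion from vertex expansion**: `4|N(T)| ≥ 7|T|` and three variables per
equation give `|T| ≤ 2|∂T|`. [folklore] -/
theorem card_le_two_mul_card_boundary {U V : Type*} [DecidableEq U] [DecidableEq V]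
    (S : U → Finset V) (T : Finset U) (h3 : ∀ u ∈ T, (S u).card = 3)
    (hexp : 7 * T.card ≤ 4 * (T.biUnion S).card) :
    T.card ≤ 2 * (XorSystem.boundary S T).card := by
  have := two_mul_card_biUnion_le S T h3
  omega

/-- There are `C(n, 3)` possible scopes of an equation — the `3`-element subsets of `Fin n`, the type
`{W : Finset (Fin n) // W ∈ powersetCard 3 (univ : Finset (Fin n))}` from which the random model draws each equation's scope.
[folklore] -/
theorem card_scope3 (n : ℕ) :
    Fintype.card {W : Finset (Fin n) // W ∈ powersetCard 3 (univ : Finset (Fin n))} = n.choose 3 :=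
  (Fintype.card_coe _).trans (by rw [card_powersetCard, card_univ, Fintype.card_fin])

/-- A scope has three elements. [folklore] -/
theorem card_eq_three_of_scope3 {n : ℕ} (X : {W : Finset (Fin n) // W ∈ powersetCard 3 (univ : Finset (Fin n))}) :
    X.1.card = 3 :=
  (mem_powersetCard.1 X.2).2

/-- The scopes inside a `w`-set `W` number at most `C(w, 3)`. [folklore] -/
theorem card_filter_subset_le {n : ℕ} (W : Finset (Fin n)) :
    (univ.filter fun X : {W : Finset (Fin n) // W ∈ powersetCard 3 (univ : Finset (Fin n))} => X.1 ⊆ W).card ≤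
      W.card.choose 3 := by
  rw [← card_powersetCard 3 W]
  refine card_le_card_of_injOn Subtype.val ?_ (Set.injOn_of_injective Subtype.val_injective)
  intro X hX
  rw [mem_coe, mem_filter] at hX
  rw [mem_coe, mem_powersetCard]
  exact ⟨hX.2, card_eq_three_of_scope3 X⟩

/-- **Existence of three-uniform vertex expanders by counting** (the role of the cited existence of
bipartite unique-neighbour expanders `(rn, n, 3, αn, β)` in the proof of AD19 Lemma 5, there referred
to Vadhan's survey): if `1 ≤ c`, `m ≤ c·n`, `3 ≤ n` and `s·(432c)⁴ ≤ n`, some system of `m` three-element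
scopes over `n` variables has `4|N(T)| ≥ 7|T|` for every set `T` of at most `s` equations.
[cite: AtseriasDawar2019, Lemma 5 (lem:linear-local-bound), proof, first paragraph] -/
theorem exists_threeUniformExpander {n m s c : ℕ} (hc : 1 ≤ c) (hm : m ≤ c * n) (hn3 : 3 ≤ n)
    (hs : s * (432 * c) ^ 4 ≤ n) :
    ∃ F : Fin m → Finset (Fin n), (∀ u, (F u).card = 3) ∧
      ∀ T : Finset (Fin m), T.card ≤ s → 7 * T.card ≤ 4 * (T.biUnion F).card := by
  classical
  set b := n.choose 3 with hb
  have hbpos : 0 < b := Nat.choose_pos hn3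
  have hL4 : 16 ≤ (432 * c) ^ 4 := by
    calc (16 : ℕ) = 2 ^ 4 := by norm_num
      _ ≤ (432 * c) ^ 4 := Nat.pow_le_pow_left (by omega) 4
  -- the size threshold `w(t) = ⌊(7t-1)/4⌋`: `t ≥ 1` equations are BAD when their variables number at
  -- most `w(t)`, i.e. fewer than `7t/4`
  let wOf : ℕ → ℕ := fun t => (7 * t - 1) / 4
  have four_mul_wOf_le : ∀ t, 4 * wOf t ≤ 7 * t := fun t => by
    show 4 * ((7 * t - 1) / 4) ≤ 7 * t; omega
  have wOf_le_two_mul : ∀ t, wOf t ≤ 2 * t := fun t => by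
    show (7 * t - 1) / 4 ≤ 2 * t; omega
  have le_wOf_of_lt : ∀ {N t : ℕ}, 4 * N < 7 * t → N ≤ wOf t := fun {N t} h => by
    show N ≤ (7 * t - 1) / 4
    rw [Nat.le_div_iff_mul_le (by norm_num)]
    omega
  -- sizes `t ≤ s` inherit the hypotheses of the per-size estimate
  have htn : ∀ t, t ≤ s → t * (432 * c) ^ 4 ≤ n := fun t ht =>
    (Nat.mul_le_mul_right _ ht).trans hs
  have hwn : ∀ t, t ≤ s → wOf t ≤ n := by
    intro t ht
    have h1 := wOf_le_two_mul t
    have h2 : 2 * t ≤ t * (432 * c) ^ 4 := by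
      rw [mul_comm]; exact Nat.mul_le_mul_left _ (by omega)
    exact h1.trans (h2.trans (htn t ht))
  -- the per-size estimate
  have hterm : ∀ t, 1 ≤ t → t ≤ s →
      m.choose t * n.choose (wOf t) * ((wOf t).choose 3 ^ t * b ^ (m - t)) * 2 ^ t ≤ b ^ m := by
    intro t ht1 hts
    rcases lt_or_ge m t with hmt | htm
    · rw [Nat.choose_eq_zero_of_lt hmt]; simp
    have key := expanderTerm_le (w := wOf t) ht1 (four_mul_wOf_le t) hc hm (htn t hts)
    calc m.choose t * n.choose (wOf t) * ((wOf t).choose 3 ^ t * b ^ (m - t)) * 2 ^ t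
        = (m.choose t * n.choose (wOf t) * (wOf t).choose 3 ^ t * 2 ^ t) * b ^ (m - t) := by ring
      _ ≤ b ^ t * b ^ (m - t) := Nat.mul_le_mul_right _ key
      _ = b ^ m := by rw [← pow_add, Nat.add_sub_cancel' htm]
  -- boxes of systems whose equations indexed by `T` have all their variables in `W`
  let box : Finset (Fin m) → Finset (Fin n) → Finset (Fin m → {W : Finset (Fin n) // W ∈ powersetCard 3 (univ : Finset (Fin n))}) := fun T W =>
    Fintype.piFinset fun u => if u ∈ T then univ.filter (fun X : {W : Finset (Fin n) // W ∈ powersetCard 3 (univ : Finset (Fin n))} => X.1 ⊆ W) else univ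
  have hbox_def : ∀ T W, box T W = Fintype.piFinset fun u =>
      if u ∈ T then univ.filter (fun X : {W : Finset (Fin n) // W ∈ powersetCard 3 (univ : Finset (Fin n))} => X.1 ⊆ W) else univ := fun _ _ => rfl
  have hbox : ∀ T W, (box T W).card ≤ (W.card.choose 3) ^ T.card * b ^ (m - T.card) := by
    intro T W
    have hf1 : (univ.filter fun u : Fin m => u ∈ T) = T := by ext; simp
    have hf2 : (univ.filter fun u : Fin m => ¬ u ∈ T) = Tᶜ := by ext; simp
    rw [hbox_def, Fintype.card_piFinset]
    simp only [apply_ite Finset.card, card_univ, card_scope3]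
    rw [prod_ite, prod_const, prod_const, hf1, hf2, card_compl, Fintype.card_fin]
    exact Nat.mul_le_mul_right _ (Nat.pow_le_pow_left (card_filter_subset_le W) _)
  -- the union bound
  let U : Finset (Fin m → {W : Finset (Fin n) // W ∈ powersetCard 3 (univ : Finset (Fin n))}) := (range s).biUnion fun i =>
    (powersetCard (i + 1) (univ : Finset (Fin m))).biUnion fun T =>
      (powersetCard (wOf (i + 1)) (univ : Finset (Fin n))).biUnion fun W => box T W
  have hU : U.card < b ^ m := by
    calc U.card ≤ ∑ i ∈ range s, ((powersetCard (i + 1) (univ : Finset (Fin m))).biUnion fun T =>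
            (powersetCard (wOf (i + 1)) (univ : Finset (Fin n))).biUnion fun W => box T W).card :=
          card_biUnion_le
      _ ≤ ∑ i ∈ range s, m.choose (i + 1) * n.choose (wOf (i + 1)) *
            ((wOf (i + 1)).choose 3 ^ (i + 1) * b ^ (m - (i + 1))) := by
          refine sum_le_sum fun i _ => ?_
          calc ((powersetCard (i + 1) (univ : Finset (Fin m))).biUnion fun T =>
                (powersetCard (wOf (i + 1)) (univ : Finset (Fin n))).biUnion fun W => box T W).card
              ≤ ∑ T ∈ powersetCard (i + 1) (univ : Finset (Fin m)),
                  ((powersetCard (wOf (i + 1)) (univ : Finset (Fin n))).biUnion fun W =>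
                    box T W).card := card_biUnion_le
            _ ≤ ∑ T ∈ powersetCard (i + 1) (univ : Finset (Fin m)),
                  ∑ W ∈ powersetCard (wOf (i + 1)) (univ : Finset (Fin n)), (box T W).card :=
                sum_le_sum fun T _ => card_biUnion_le
            _ ≤ ∑ T ∈ powersetCard (i + 1) (univ : Finset (Fin m)),
                  ∑ W ∈ powersetCard (wOf (i + 1)) (univ : Finset (Fin n)),
                    (wOf (i + 1)).choose 3 ^ (i + 1) * b ^ (m - (i + 1)) := by
                refine sum_le_sum fun T hT => sum_le_sum fun W hW => ?_
                have h := hbox T W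
                rwa [(mem_powersetCard.1 hT).2, (mem_powersetCard.1 hW).2] at h
            _ = m.choose (i + 1) * n.choose (wOf (i + 1)) *
                  ((wOf (i + 1)).choose 3 ^ (i + 1) * b ^ (m - (i + 1))) := by
                rw [sum_const, smul_eq_mul, sum_const, smul_eq_mul, card_powersetCard,
                  card_powersetCard, card_univ, card_univ, Fintype.card_fin, Fintype.card_fin]
                ring
      _ < b ^ m :=
          Literature.Combinatorics.Expanders.sum_lt_of_mul_two_pow_le _ (pow_pos hbpos _)
            fun i hi => hterm (i + 1) i.succ_pos hi
  have hUuniv : U.card < (univ : Finset (Fin m → {W : Finset (Fin n) // W ∈ powersetCard 3 (univ : Finset (Fin n))})).card := by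
    rw [card_univ, Fintype.card_fun, card_scope3, Fintype.card_fin]
    exact hU
  obtain ⟨F, -, hFU⟩ := exists_mem_notMem_of_card_lt_card hUuniv
  refine ⟨fun u => (F u).1, fun u => card_eq_three_of_scope3 (F u), fun T hT => ?_⟩
  by_contra hlt
  have hlt' : 4 * (T.biUnion fun u => (F u).1).card < 7 * T.card := Nat.lt_of_not_le hlt
  have hTpos : 1 ≤ T.card := by omega
  have hN : (T.biUnion fun u => (F u).1).card ≤ wOf T.card := le_wOf_of_lt hlt'
  obtain ⟨W, hWsub, hWcard⟩ :=
    Finset.exists_superset_card_eq hN ((hwn _ hT).trans (by simp))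
  apply hFU
  simp only [U, mem_biUnion, mem_range, mem_powersetCard]
  have ht' : T.card - 1 + 1 = T.card := Nat.sub_add_cancel hTpos
  refine ⟨T.card - 1, by omega, T, ⟨subset_univ _, ht'.symm⟩, W, ⟨subset_univ _, by rw [ht', hWcard]⟩,
    ?_⟩
  rw [hbox_def, Fintype.mem_piFinset]
  intro u
  split_ifs with hu
  · exact mem_filter.2 ⟨mem_univ _, (subset_biUnion_of_mem (fun u => (F u).1) hu).trans hWsub⟩
  · exact mem_univ _

end Expander

/-! ### 2. Random right-hand sides (Lemma 4 for `G(Ax=b)`) -/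

section RandomRHS

variable {V : Type*} {n m : ℕ}

/-- For one equation `e : x + y + z = β`, the number `Y_{g,e}` of the eight doubled equations
`x^{a₁} + y^{a₂} + z^{a₃} = β + a₁ + a₂ + a₃` satisfied by an assignment `g` of `G` is at most `8`
(eight times the printed `Y_{f,u} ∈ [0, 1]`). [cite: AtseriasDawar2019, Lemma 4 (lem:both-extremal), proof] -/
theorem satCount_double_le (e : Xor3.Equation V) (g : V × ZMod 2 → ZMod 2) :
    (Xor3.Equation.double e).satCount g ≤ 8 :=
  (Multiset.countP_le_card _ _).trans (Xor3.Equation.card_double e).le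

/-- **For each sign pattern exactly one right-hand side is satisfied**: `Y_{g,(x+y+z=0)} + Y_{g,(x+y+z=1)} = 8`
(so `Y` has mean `4` under a uniformly random right-hand side — the content of the printed "the
expectation of `Y_{f,u}` is `1/2` in either case", without the case analysis).
[cite: AtseriasDawar2019, Lemma 4 (lem:both-extremal), proof] -/
theorem satCount_double_zero_add_one (x y z : V) (g : V × ZMod 2 → ZMod 2) :
    (Xor3.Equation.double (x, y, z, 0)).satCount g + (Xor3.Equation.double (x, y, z, 1)).satCount g = 8 := by
  classical
  -- the doubled equation with signs `a` and right-hand side `β` holds iff `β` is the defect `τ a`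
  let τ : ZMod 2 × ZMod 2 × ZMod 2 → ZMod 2 := fun a =>
    g (x, a.1) + g (y, a.2.1) + g (z, a.2.2) - (a.1 + a.2.1 + a.2.2)
  have hY : ∀ β : ZMod 2, (Xor3.Equation.double (x, y, z, β)).satCount g =
      ((univ : Finset (ZMod 2 × ZMod 2 × ZMod 2)).filter fun a => τ a = β).card := by
    intro β
    unfold Xor3.Instance.satCount Xor3.Equation.double
    rw [Multiset.countP_map]
    change Finset.card (Finset.filter _ univ) = _
    congr 1
    refine filter_congr fun a _ => ?_
    simp only [Xor3.Equation.IsSatBy, τ]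
    constructor
    · intro h; linear_combination h
    · intro h; linear_combination h
  have h1 : ((univ : Finset (ZMod 2 × ZMod 2 × ZMod 2)).filter fun a => τ a = 1) =
      (univ : Finset (ZMod 2 × ZMod 2 × ZMod 2)).filter fun a => ¬ τ a = 0 := by
    refine filter_congr fun a _ => ?_
    have key : ∀ v : ZMod 2, v = 1 ↔ ¬ v = 0 := by decide
    exact key _
  rw [hY, hY, h1, card_filter_add_card_filter_not]
  simp

/-- **The satisfied count of `G(Ax=b)` is the sum over the rows `u` of the `Y_{g,u}(b_u)`**, for the
instance `Ax = b` with equations `x_u + y_u + z_u = b_u`, `u : Fin m` ("one equation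
`e_u : x_{v₁(u)} + x_{v₂(u)} + x_{v₃(u)} = b_u` for each `u ∈ U`").
[cite: AtseriasDawar2019, Lemma 4 (lem:both-extremal), proof] -/
theorem satCount_double_rows (x y z : Fin m → Fin n) (b : Fin m → ZMod 2)
    (g : Fin n × ZMod 2 → ZMod 2) :
    (Xor3.Instance.double
        (((univ : Finset (Fin m)).val.map fun u => (x u, y u, z u, b u)) : Xor3.Instance (Fin n))).satCount
        g = ∑ u, (Xor3.Equation.double (x u, y u, z u, b u)).satCount g := by
  classical
  unfold Xor3.Instance.satCount Xor3.Instance.double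
  rw [Multiset.countP_eq_card_filter, Multiset.filter_bind, Multiset.card_bind, Multiset.map_map,
    Finset.sum_eq_multiset_sum]
  congr 1
  refine Multiset.map_congr rfl fun u _ => ?_
  simp only [Function.comp_apply, Multiset.countP_eq_card_filter]

/-- **Hoeffding for one assignment** (the printed "by Hoeffding's inequality, the probability that
`Y_f ≥ 1/2 + ε` is at most `e^{-2ε²m}`"), counting form: if `Y_u(0) + Y_u(1) = 8` for every row `u`, the
right-hand sides `b ∈ 𝔽₂^m` with `Σ_u (Y_u(b_u) - 4) ≥ 8εm` number at most `e^{-2ε²m} · 2^m` (the tree's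
`hoeffding_count_pi` with ranges `c_u = 4`). [cite: AtseriasDawar2019, Lemma 4 (lem:both-extremal), proof] -/
theorem card_badRhs_le (Y : Fin m → ZMod 2 → ℕ) (h8 : ∀ u, Y u 0 + Y u 1 = 8) {ε : ℝ} (hε : 0 ≤ ε)
    (hm : 0 < m) :
    (((univ : Finset (Fin m → ZMod 2)).filter fun b =>
        8 * ε * m ≤ ∑ u, ((Y u (b u) : ℝ) - 4)).card : ℝ) ≤ Real.exp (-(2 * ε ^ 2 * m)) * 2 ^ m := by
  classical
  have h01 : ∀ β : ZMod 2, β = 0 ∨ β = 1 := by decide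
  have hle : ∀ u β, Y u β ≤ 8 := by
    intro u β
    rcases h01 β with rfl | rfl
    · have := h8 u; omega
    · have := h8 u; omega
  have hf0 : ∀ u : Fin m, ∑ β : ZMod 2, ((Y u β : ℝ) - 4) = 0 := by
    intro u
    have huniv : (univ : Finset (ZMod 2)) = {0, 1} := by decide
    rw [huniv, sum_pair (by decide)]
    have h8' : ((Y u 0 : ℕ) : ℝ) + (Y u 1 : ℕ) = 8 := by exact_mod_cast h8 u
    linarith
  have hfc : ∀ (u : Fin m) (β : ZMod 2), |((Y u β : ℝ) - 4)| ≤ (fun _ : Fin m => (4 : ℝ)) u := by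
    intro u β
    have h1 : ((Y u β : ℕ) : ℝ) ≤ 8 := by exact_mod_cast hle u β
    have h2 : (0 : ℝ) ≤ (Y u β : ℕ) := Nat.cast_nonneg _
    rw [abs_sub_le_iff]
    constructor <;> linarith
  have hS : (0 : ℝ) < ∑ u : Fin m, (fun _ : Fin m => (4 : ℝ)) u ^ 2 := by
    rw [sum_const, card_univ, Fintype.card_fin, nsmul_eq_mul]
    have : (0 : ℝ) < m := by exact_mod_cast hm
    positivity
  have h := Literature.Probability.Moments.hoeffding_count_pi (κ := fun _ : Fin m => ZMod 2)
    (fun u β => (Y u β : ℝ) - 4) (fun _ => 4) hf0 hfc (t := 8 * ε * m) (by positivity) hS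
  have hsum : ∑ u : Fin m, (fun _ : Fin m => (4 : ℝ)) u ^ 2 = 16 * m := by
    rw [sum_const, card_univ, Fintype.card_fin, nsmul_eq_mul]; ring
  have hprod : ∏ _u : Fin m, (Fintype.card (ZMod 2) : ℝ) = 2 ^ m := by
    rw [prod_const, card_univ, Fintype.card_fin, ZMod.card]; norm_num
  have hm' : (m : ℝ) ≠ 0 := by exact_mod_cast hm.ne'
  calc _ ≤ _ := h
    _ = Real.exp (-(2 * ε ^ 2 * m)) * 2 ^ m := by
        rw [hprod, hsum]
        congr 3
        field_simp
        ring

/-- **AD19 Lemma 4 for `G(Ax=b)`, union bound** (existence form): if every assignment `g` of the `2n`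
doubled variables has per-row counts `Y_{g,u}` with `Y_{g,u}(0) + Y_{g,u}(1) = 8`, and `4^n < e^{2ε²m}`
(e.g. `m = cn`, `c ≥ 1/ε²`, `n ≥ 1`), then some right-hand side `b` keeps `Σ_u Y_{g,u}(b_u)` below
`(1/2+ε)·8m` for ALL `4^n` assignments `g` at once ("by the union bound, the probability that some `f`
satisfies `Y_f ≥ 1/2+ε` is at most `4^n e^{-2ε²m}`" — the text prints `2^n`).
[cite: AtseriasDawar2019, Lemma 4 (lem:both-extremal)] -/
theorem exists_rhs_sum_lt (Y : (Fin n × ZMod 2 → ZMod 2) → Fin m → ZMod 2 → ℕ)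
    (h8 : ∀ g u, Y g u 0 + Y g u 1 = 8) {ε : ℝ} (hε : 0 < ε) (hm : 0 < m)
    (hkey : (4 : ℝ) ^ n < Real.exp (2 * ε ^ 2 * m)) :
    ∃ b : Fin m → ZMod 2, ∀ g, (∑ u, (Y g u (b u) : ℝ)) < (1 / 2 + ε) * (8 * m) := by
  classical
  let bad : (Fin n × ZMod 2 → ZMod 2) → Finset (Fin m → ZMod 2) := fun g =>
    univ.filter fun b => 8 * ε * m ≤ ∑ u, ((Y g u (b u) : ℝ) - 4)
  let Bad : Finset (Fin m → ZMod 2) := (univ : Finset (Fin n × ZMod 2 → ZMod 2)).biUnion bad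
  have h3 : (univ : Finset (Fin m → ZMod 2)).card = 2 ^ m := by
    rw [card_univ, Fintype.card_fun, ZMod.card, Fintype.card_fin]
  have h4 : (Fintype.card (Fin n × ZMod 2 → ZMod 2) : ℝ) = 4 ^ n := by
    rw [Fintype.card_fun, Fintype.card_prod, ZMod.card, Fintype.card_fin, pow_mul']
    norm_num
  have hBad : (Bad.card : ℝ) < (univ : Finset (Fin m → ZMod 2)).card := by
    have h1 : (Bad.card : ℝ) ≤ ∑ g : (Fin n × ZMod 2 → ZMod 2), ((bad g).card : ℝ) := by
      exact_mod_cast card_biUnion_le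
    have h2 : ∑ g : (Fin n × ZMod 2 → ZMod 2), ((bad g).card : ℝ) ≤
        4 ^ n * (Real.exp (-(2 * ε ^ 2 * m)) * 2 ^ m) := by
      calc ∑ g : (Fin n × ZMod 2 → ZMod 2), ((bad g).card : ℝ)
          ≤ ∑ _g : (Fin n × ZMod 2 → ZMod 2), Real.exp (-(2 * ε ^ 2 * m)) * 2 ^ m :=
            sum_le_sum fun g _ => card_badRhs_le (Y g) (h8 g) hε.le hm
        _ = 4 ^ n * (Real.exp (-(2 * ε ^ 2 * m)) * 2 ^ m) := by
            rw [sum_const, card_univ, nsmul_eq_mul, h4]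
    rw [h3]
    push_cast
    calc (Bad.card : ℝ) ≤ 4 ^ n * (Real.exp (-(2 * ε ^ 2 * m)) * 2 ^ m) := h1.trans h2
      _ < Real.exp (2 * ε ^ 2 * m) * (Real.exp (-(2 * ε ^ 2 * m)) * 2 ^ m) :=
          mul_lt_mul_of_pos_right hkey (by positivity)
      _ = 2 ^ m := by rw [← mul_assoc, ← Real.exp_add, add_neg_cancel, Real.exp_zero, one_mul]
  have hBad' : Bad.card < (univ : Finset (Fin m → ZMod 2)).card := by exact_mod_cast hBad
  obtain ⟨b, -, hb⟩ := exists_mem_notMem_of_card_lt_card hBad'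
  refine ⟨b, fun g => ?_⟩
  by_contra hge
  apply hb
  rw [mem_biUnion]
  refine ⟨g, mem_univ _, mem_filter.2 ⟨mem_univ _, ?_⟩⟩
  rw [sum_sub_distrib, sum_const, card_univ, Fintype.card_fin, nsmul_eq_mul]
  linarith [not_lt.1 hge]

/-- **AD19 Lemma 4 for `G(Ax=b)`** (existence form): for rows `x_u + y_u + z_u`, `u : Fin m`, over `n`
variables with `4^n < e^{2ε²m}`, some right-hand side `b` makes the doubling `G(Ax = b)` NOT
`(1/2+ε)`-satisfiable. [cite: AtseriasDawar2019, Lemma 4 (lem:both-extremal)] -/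
theorem exists_rhs_not_isCSat_double (x y z : Fin m → Fin n) {ε : ℝ} (hε : 0 < ε) (hm : 0 < m)
    (hkey : (4 : ℝ) ^ n < Real.exp (2 * ε ^ 2 * m)) :
    ∃ b : Fin m → ZMod 2, ¬ (Xor3.Instance.double
      (((univ : Finset (Fin m)).val.map fun u => (x u, y u, z u, b u)) : Xor3.Instance (Fin n))).IsCSat
        (1 / 2 + ε) := by
  obtain ⟨b, hb⟩ := exists_rhs_sum_lt
    (fun g u β => (Xor3.Equation.double (x u, y u, z u, β)).satCount g)
    (fun g u => satCount_double_zero_add_one (x u) (y u) (z u) g) hε hm hkey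
  refine ⟨b, ?_⟩
  rintro ⟨g, hg⟩
  rw [Xor3.Instance.card_double, Multiset.card_map, card_val, card_univ, Fintype.card_fin,
    satCount_double_rows] at hg
  push_cast at hg
  exact absurd (hb g) (not_lt.2 hg)

end RandomRHS

/-! ### 3. Duplicator's strategy from boundary expansion (Lemma 5, Claims 6–7) -/

section Strategy

variable {n m : ℕ}

/-- **AD19 Lemma 5 / Claim 7 on a boundary expander**: if every set `T` of at most `s ≥ 1` rows has
`|T| ≤ 2|∂T|` and `4k ≤ s`, then `Ax = b` (rows `x_u + y_u + z_u = b_u` on three distinct variables) is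
`k`-locally satisfiable for EVERY `b`. Duplicator's winning positions are the partial assignments
consistent at radius `s` (`XorSystem.Good`, whose extension property `XorSystem.good_extend` is the
tree's direct proof of what the text obtains through resolution width and the Atserias–Dalmau game).
[cite: AtseriasDawar2019, Lemma 5 (lem:linear-local-bound), Claim 7] -/
theorem isLocallySat_rows (F : Fin m → Finset (Fin n)) (x y z : Fin m → Fin n)
    (hxy : ∀ u, x u ≠ y u) (hxz : ∀ u, x u ≠ z u) (hyz : ∀ u, y u ≠ z u)
    (hF : ∀ u, F u = {x u, y u, z u}) (b : Fin m → ZMod 2) {s k : ℕ} (hs : 1 ≤ s) (hk : 4 * k ≤ s)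
    (hexp : ∀ T : Finset (Fin m), T.card ≤ s → T.card ≤ 2 * (XorSystem.boundary F T).card) :
    Xor3.Instance.IsLocallySat k
      (((univ : Finset (Fin m)).val.map fun u => (x u, y u, z u, b u)) : Xor3.Instance (Fin n)) := by
  classical
  have hexp' : ∀ T : Finset (Fin m), T.card ≤ s → 1 * T.card ≤ 2 * (XorSystem.boundary F T).card := by
    simpa using hexp
  have hK : 2 * 2 * k ≤ 1 * s := by omega
  -- finite sets of variables as finsets
  let fs : Set (Fin n) → Finset (Fin n) := fun D => (Set.toFinite D).toFinset
  have hfs_mem : ∀ (D : Set (Fin n)) (v : Fin n), v ∈ fs D ↔ v ∈ D := fun D v =>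
    Set.Finite.mem_toFinset _
  have hfs_card : ∀ D : Set (Fin n), (fs D).card = D.ncard := fun D =>
    (Set.ncard_eq_toFinset_card D (Set.toFinite D)).symm
  have hfs_empty : fs ∅ = ∅ := by ext v; simp [hfs_mem]
  have hfs_insert : ∀ (D : Set (Fin n)) (v : Fin n), fs (insert v D) = insert v (fs D) := by
    intro D v; ext w; simp [hfs_mem, Set.mem_insert_iff]
  have hfs_mono : ∀ D D' : Set (Fin n), D' ⊆ D → fs D' ⊆ fs D := by
    intro D D' h w hw; rw [hfs_mem] at hw ⊢; exact h hw
  refine ⟨{ carrier := {p | p.1.ncard ≤ k ∧ XorSystem.Good F b s (fs p.1) p.2}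
            empty_mem := ?_
            finite_of_mem := fun D _ _ => Set.toFinite D
            ncard_le_of_mem := fun D f h => h.1
            isSatBy_of_mem := ?_
            mem_of_subset := ?_
            forth := ?_ }⟩
  · refine ⟨fun _ => 0, ?_, ?_⟩
    · simp
    · show XorSystem.Good F b s (fs ∅) fun _ => 0
      rw [hfs_empty]
      exact XorSystem.good_empty one_pos hexp' _
  · rintro D f ⟨-, hg⟩ e he h1 h2 h3
    obtain ⟨u, -, rfl⟩ := Multiset.mem_map.1 he
    have hsub : F u ⊆ fs D := by
      rw [hF u]
      intro w hw
      simp only [mem_insert, mem_singleton] at hw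
      rw [hfs_mem]
      rcases hw with rfl | rfl | rfl
      · exact h1
      · exact h2
      · exact h3
    have hsum := hg.sum_scope_eq hs hsub
    rw [hF u, sum_insert (by simp [hxy u, hxz u]), sum_insert (by simp [hyz u]), sum_singleton] at hsum
    show f (x u) + f (y u) + f (z u) = b u
    rw [← hsum, add_assoc]
  · rintro D f ⟨hkD, hg⟩ D' hD'
    exact ⟨(Set.ncard_le_ncard hD' (Set.toFinite D)).trans hkD, hg.mono (hfs_mono D D' hD')⟩
  · rintro D f ⟨-, hg⟩ hDk v
    have hcard : (fs D).card < k := by rw [hfs_card]; exact hDk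
    obtain ⟨g', hg', hagree⟩ := XorSystem.good_extend one_pos hexp' hK hg hcard v
    refine ⟨g', fun w hw => hagree w ((hfs_mem D w).2 hw), ?_, ?_⟩
    · exact (Set.ncard_insert_le v D).trans (Nat.succ_le_of_lt hDk)
    · show XorSystem.Good F b s (fs (insert v D)) g'
      rw [hfs_insert]
      exact hg'

end Strategy

end Xor3Gap

/-! ### 4. The named fact -/

/-- **The local-consistency gap for 3XOR — proof of the named fact `AtseriasDawar2019_xorLocalGap`**
("By combining Lemma 5 with Lemma 4, there is a family of systems `(S_k)_{k ≥ 1}` with `O(k)` variables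
and equations such that `G(S_k)` is not `(1/2+ε)`-satisfiable but `S_k` is `k`-locally satisfiable").
Constants: `c₁ = max ⌈1/ε²⌉ 1`, `L = 432c₁`, `c = 8c₁L⁴`; for `k ≥ 1`: `n = 8L⁴k` variables, `m = c₁n`
equations (a three-uniform expander from `Xor3Gap.exists_threeUniformExpander`, radius `s = 4k`),
right-hand side from `Xor3Gap.exists_rhs_not_isCSat_double` (`4^n < e^{2n} ≤ e^{2ε²m}`), strategy from
`Xor3Gap.isLocallySat_rows`.
[cite: AtseriasDawar2019, Thm 8 (thm:3lin-onesided), proof, via Lemma 5 (lem:linear-local-bound) and Lemma 4 (lem:both-extremal)] -/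
theorem AtseriasDawar2019_xorLocalGap_holds : AtseriasDawar2019_xorLocalGap := by
  classical
  intro ε hε
  -- the constants
  obtain ⟨c₁, hc₁1, hc₁ε⟩ : ∃ c₁ : ℕ, 1 ≤ c₁ ∧ 1 / ε ^ 2 ≤ (c₁ : ℝ) :=
    ⟨max ⌈1 / ε ^ 2⌉₊ 1, le_max_right _ _,
      (Nat.le_ceil _).trans (by exact_mod_cast le_max_left _ _)⟩
  set L : ℕ := 432 * c₁ with hL
  have hL1 : 432 ≤ L := by omega
  refine ⟨8 * c₁ * L ^ 4, fun k hk => ?_⟩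
  -- the sizes
  set n : ℕ := 8 * L ^ 4 * k with hn
  have hL4 : 1 ≤ L ^ 4 := Nat.one_le_pow _ _ (by omega)
  have hn8 : 8 ≤ n := by
    have : 8 * 1 * 1 ≤ 8 * L ^ 4 * k := by gcongr
    simpa [hn] using this
  have hn3 : 3 ≤ n := by omega
  have hn0 : n ≠ 0 := by omega
  have hsn : (4 * k) * (432 * c₁) ^ 4 ≤ n := by
    rw [hn, ← hL]
    calc 4 * k * L ^ 4 = 4 * (L ^ 4 * k) := by ring
      _ ≤ 8 * (L ^ 4 * k) := Nat.mul_le_mul_right _ (by norm_num)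
      _ = 8 * L ^ 4 * k := by ring
  have hm0 : 0 < c₁ * n := Nat.mul_pos (by omega) (by omega)
  -- Lemma 5, first step: the expander
  obtain ⟨F, hF3, hFexp⟩ := Xor3Gap.exists_threeUniformExpander (m := c₁ * n) hc₁1 le_rfl hn3 hsn
  have hbd : ∀ T : Finset (Fin (c₁ * n)), T.card ≤ 4 * k →
      T.card ≤ 2 * (XorSystem.boundary F T).card := fun T hT =>
    Xor3Gap.card_le_two_mul_card_boundary F T (fun u _ => hF3 u) (hFexp T hT)
  -- ordered triples of distinct variables
  choose x y z hxy hxz hyz hF using fun u => card_eq_three.1 (hF3 u)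
  -- Lemma 4: the right-hand side
  have hkey : (4 : ℝ) ^ n < Real.exp (2 * ε ^ 2 * (c₁ * n : ℕ)) := by
    have he1 : (2 : ℝ) < Real.exp 1 := by
      have := Real.add_one_lt_exp (by norm_num : (1 : ℝ) ≠ 0)
      linarith
    have he2 : (4 : ℝ) < Real.exp 2 := by
      rw [show (2 : ℝ) = 1 + 1 by norm_num, Real.exp_add]
      nlinarith [Real.exp_pos 1]
    have hεc : 1 ≤ ε ^ 2 * c₁ := by
      have hε2 : 0 < ε ^ 2 := by positivity
      rw [div_le_iff₀ hε2] at hc₁ε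
      linarith
    calc (4 : ℝ) ^ n < Real.exp 2 ^ n := pow_lt_pow_left₀ he2 (by norm_num) hn0
      _ = Real.exp (2 * n) := by rw [← Real.exp_nat_mul]; ring_nf
      _ ≤ Real.exp (2 * ε ^ 2 * (c₁ * n : ℕ)) := by
          rw [Real.exp_le_exp]
          push_cast
          have : (0 : ℝ) ≤ n := Nat.cast_nonneg n
          nlinarith
  obtain ⟨b, hb⟩ := Xor3Gap.exists_rhs_not_isCSat_double x y z hε hm0 hkey
  refine ⟨n, ((univ : Finset (Fin (c₁ * n))).val.map fun u => (x u, y u, z u, b u)),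
    ?_, ?_, ?_, ?_, hb⟩
  · -- `n ≤ c k`
    rw [hn]
    gcongr
    omega
  · -- `m ≤ c k`
    rw [Multiset.card_map, card_val, card_univ, Fintype.card_fin, hn]
    exact le_of_eq (by ring)
  · -- three distinct variables per equation
    intro e he
    obtain ⟨u, -, rfl⟩ := Multiset.mem_map.1 he
    exact ⟨hxy u, hxz u, hyz u⟩
  · -- `k`-local satisfiability (Lemma 5)
    exact Xor3Gap.isLocallySat_rows F x y z hxy hxz hyz hF b (s := 4 * k) (by omega) le_rfl hbd

end Literature.ModelTheory.FiniteModelTheory
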